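import Summits.BirchSwinnertonDyer.BirchSwinnertonDyer.Theorems.ManinLocalTwoThreeTamagawaTwoAtFourHolds
import Summits.BirchSwinnertonDyer.BirchSwinnertonDyer.Theorems.ManinLocalTwoThreeConductorExponentThreeAtTwo
import Literature.NumberTheory.EllipticCurves.NeronComponentIndexProofs
import Literature.NumberTheory.EllipticCurves.NeronComponentIndexTypeIIIProofs
import Literature.NumberTheory.EllipticCurves.NeronComponentIndexTypeIIIstarProofs
import Literature.NumberTheory.EllipticCurves.NeronComponentIndexTypeInstarProofs
import HarnessLib

/-!
# The E-blind Tate package at `8 ∥ N` (`f₂ = 3`): Kodaira `III/4 · I₁*/8 · III*/10 · II*/11`, `c₂ ∈ {1, 2, 4}` by type, `E(ℚ)[3] = 0`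
# (route `ManinLocalTwoThree`, cell bsd-f2-manin, crux C2 `ManinOddAtFour` stmt-BirchSwinnertonDyer-22967; prover seat p3 gen 13 —
# the `8 ∥ N` twin of this seat's `…TamagawaTwoAtFourHolds` (p707853), for desc g19's `8 ∥ N` stratum of the Brandt-height series)

desc g19 (STATUS 09:51Z) opens the next stratum `8 ∥ N` (`f₂ = 3`; Cremona `N < 10⁴`: III 1060 · I₁* 1020 · III* 655 · II* 418).  At `4 ∥ N`
desc's rows carried two NAMED Tate nodes (`TamagawaTwoMemOneThreeAtFour`, `TamagawaTwoOfThreeTorsionAtFour`), discharged by this seat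
(p707853).  This file lands the `8 ∥ N` analogues BEFORE they are named, in desc's currencies (`tamagawaAt W 2`, `padicValRat 2 W.Δ`,
`RamanujanCut.HasRationalThreeTorsion`):

* §1 `conductorExponent_vTwo_eq_three_of_padicValNat_conductorNorm` — `v₂(N) = 3 ⟹ f_{v₂} = 3` at the place of `𝓞 ℚ` over `2`;
* §2 `kodairaSymbolAt_vTwo_of_padicValNat_conductorNorm_eq_three` — the type list `III/4 · I₁*/8 · III*/10 · II*/11` at that place
  (p2's `kodairaSymbolAt_of_conductorExponent_eq_three_of_irreducible_two`, generic over a Dedekind base, specialised), and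
  `padicValInt_two_minimalDiscriminantInt_of_padicValNat_conductorNorm_eq_three` / `padicValRat_two_Δ_of_padicValNat_conductorNorm_eq_three` —
  **`8 ∥ N ⟹ v₂(Δ_min) ∈ {4, 8, 10, 11}`** on a global minimal model;
* §3 `tamagawaAt_two_of_padicValNat_conductorNorm_eq_three` — **`8 ∥ N ⟹ c₂ ∈ {1, 2, 4}`**, with the by-type values
  (`…_by_type`: III ↦ 2, I₁* ↦ 2 ∨ 4, III* ↦ 2, II* ↦ 1; Tate Steps 4, 7, 9, 10) and `tamagawaAt_two_eq_one_iff_IIstar_…`;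
* §4 **`not_hasRationalThreeTorsion_of_padicValNat_conductorNorm_eq_three` — `8 ∥ N(E) ⟹ E(ℚ)[3] = 0`**: additive reduction at `2`
  with a rational `3`-torsion point forces `3 ∣ c₂` (p707853 §3, Silverman *AEC* VII.2.1/VII.3.1), impossible for `c₂ ∈ {1, 2, 4}`.

HONEST FRAMING.  Local bookkeeping from Tate's algorithm (in print), kernel-checked; nothing about C2, Manin's conjecture or BSD is proved.
No definitions, no sorry, axioms standard.

[cite: SilvermanATAEC1994, IV.9.4 Steps 4, 7, 9, 10 and Table 4.1 (PDF pp. 344–346, 365)] [cite: Papadopoulos1993, Table IV (p = 2)]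
[cite: SilvermanAEC2009, VII.2 Prop. 2.1, VII.3 Prop. 3.1, C.16]
-/

set_option autoImplicit false
-- lint-debt: the directory name repeats the summit name (sibling precedent `ManinLocalTwoThreeTamagawaTwoAtFourHolds.lean`)
set_option linter.dupNamespace false

noncomputable section

open scoped Classical NumberField
open IsDedekindDomain IsDedekindDomain.HeightOneSpectrum Rat.HeightOneSpectrum
open WeierstrassCurve Literature.NumberTheory.DiophantineGeometry Literature.NumberTheory.EllipticCurves
open Summit.BirchSwinnertonDyer.Rank1Residual.ManinAdditive
open Summit.BirchSwinnertonDyer.Rank1Residual.ManinAdditive.RamanujanCut (HasRationalThreeTorsion)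
open Summit.BirchSwinnertonDyer.Rank1Residual.ManinAdditive.ThetaBrandt

namespace Summit.BirchSwinnertonDyer.BirchSwinnertonDyer.Theorems.ManinLocalTwoThree

/-! ## §1 `8 ∥ N ⟹ f_{v₂} = 3` -/

/-- **`8 ∥ N_E ⟹ f_{v₂} = 3`** at the place of `𝓞 ℚ` over `2` (`N_E = ∏ p ^ f_p`; the exponent at the place of `𝓞 ℚ` is the one at the
place of `ℤ`, `conductorExponent_eq_of_primesEquiv_eq`). [cite: SilvermanAEC2009, C.16 (definition of the conductor)] -/
theorem conductorExponent_vTwo_eq_three_of_padicValNat_conductorNorm (W : WeierstrassCurve ℚ) [W.IsElliptic]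
    (h3 : padicValNat 2 (W.conductorNorm ℤ) = 3) :
    W.conductorExponent ((primesEquiv (R := 𝓞 ℚ)).symm ⟨2, Nat.prime_two⟩) = 3 := by
  have h1 := factorization_conductorNorm_holds W ((primesEquiv (R := ℤ)).symm ⟨2, Nat.prime_two⟩)
  rw [show natGenerator ((primesEquiv (R := ℤ)).symm ⟨2, Nat.prime_two⟩) = 2 from
    congrArg Subtype.val ((primesEquiv (R := ℤ)).apply_symm_apply ⟨2, Nat.prime_two⟩),
    Nat.factorization_def _ Nat.prime_two, h3] at h1
  rw [← WeierstrassCurve.conductorExponent_eq_of_primesEquiv_eq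
    ((primesEquiv (R := ℤ)).symm ⟨2, Nat.prime_two⟩) ((primesEquiv (R := 𝓞 ℚ)).symm ⟨2, Nat.prime_two⟩) W
    (by simp)]
  exact h1.symm

/-- `8 ∥ N` in divisibility form is `v₂(N) = 3`. [folklore] -/
theorem padicValNat_conductorNorm_eq_three_of_dvd (W : WeierstrassCurve ℚ) [W.IsElliptic]
    (h8 : 2 ^ 3 ∣ W.conductorNorm ℤ) (h16 : ¬ 2 ^ 4 ∣ W.conductorNorm ℤ) : padicValNat 2 (W.conductorNorm ℤ) = 3 := by
  have hN : W.conductorNorm ℤ ≠ 0 := (conductorNorm_pos_holds W).ne'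
  rw [padicValNat_dvd_iff_le hN] at h8 h16
  omega

/-! ## §2 The Kodaira type at `2` and `v₂(Δ_min)` at `8 ∥ N` -/

/-- **`8 ∥ N ⟹` Kodaira `III` (`ord₂ Δ_min = 4`), `I₁*` (`8`), `III*` (`10`) or `II*` (`11`) at the place of `𝓞 ℚ` over `2`** (p2's `f₂ = 3`
list, generic over a Dedekind base, at `v₂`; `2` is a uniformiser of `ℤ₂`). [cite: SilvermanATAEC1994, IV.9.4 and Table 4.1]
[cite: Papadopoulos1993, Table IV (p = 2)] -/
theorem kodairaSymbolAt_vTwo_of_padicValNat_conductorNorm_eq_three (W : WeierstrassCurve ℚ) [W.IsElliptic]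
    (h3 : padicValNat 2 (W.conductorNorm ℤ) = 3) :
    (W.kodairaSymbolAt ((primesEquiv (R := 𝓞 ℚ)).symm ⟨2, Nat.prime_two⟩) = .III ∧
        W.ordMinimalDiscriminant ((primesEquiv (R := 𝓞 ℚ)).symm ⟨2, Nat.prime_two⟩) = 4) ∨
      (W.kodairaSymbolAt ((primesEquiv (R := 𝓞 ℚ)).symm ⟨2, Nat.prime_two⟩) = .Istar 1 ∧
        W.ordMinimalDiscriminant ((primesEquiv (R := 𝓞 ℚ)).symm ⟨2, Nat.prime_two⟩) = 8) ∨
      (W.kodairaSymbolAt ((primesEquiv (R := 𝓞 ℚ)).symm ⟨2, Nat.prime_two⟩) = .IIIstar ∧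
        W.ordMinimalDiscriminant ((primesEquiv (R := 𝓞 ℚ)).symm ⟨2, Nat.prime_two⟩) = 10) ∨
      (W.kodairaSymbolAt ((primesEquiv (R := 𝓞 ℚ)).symm ⟨2, Nat.prime_two⟩) = .IIstar ∧
        W.ordMinimalDiscriminant ((primesEquiv (R := 𝓞 ℚ)).symm ⟨2, Nat.prime_two⟩) = 11) := by
  haveI : PerfectField (IsLocalRing.ResidueField (((primesEquiv (R := 𝓞 ℚ)).symm ⟨2, Nat.prime_two⟩).adicCompletionIntegers ℚ)) :=
    PerfectField.ofFinite
  have h2v : (2 : 𝓞 ℚ) ∈ ((primesEquiv (R := 𝓞 ℚ)).symm ⟨2, Nat.prime_two⟩).asIdeal := by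
    have h := (natCast_mem_asIdeal_iff_eq_primesEquiv_symm
      ((primesEquiv (R := 𝓞 ℚ)).symm ⟨2, Nat.prime_two⟩) Nat.prime_two).mpr rfl
    simpa using h
  exact kodairaSymbolAt_of_conductorExponent_eq_three_of_irreducible_two _ W
    (irreducible_two_adicCompletionIntegers _ (Rat.valuation_two_of_two_mem h2v))
    (conductorExponent_vTwo_eq_three_of_padicValNat_conductorNorm W h3)

/-- **`8 ∥ N ⟹ ord₂(Δ_min) ∈ {4, 8, 10, 11}`** for a globally minimal `W` (the four types `III/4`, `I₁*/8`, `III*/10`, `II*/11` at the place of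
`ℤ` over `2`, p2's `kodairaSymbolAt_of_conductorExponent_eq_three_two`, and `ordMinimalDiscriminant_eq_padicValInt_natGenerator'`).
[cite: SilvermanATAEC1994, IV.9.4 and Table 4.1] [cite: Papadopoulos1993, Table IV (p = 2)] -/
theorem padicValInt_two_minimalDiscriminantInt_of_padicValNat_conductorNorm_eq_three (W : WeierstrassCurve ℚ) [W.IsElliptic]
    [W.IsGloballyMinimal] (h3 : padicValNat 2 (W.conductorNorm ℤ) = 3) :
    padicValInt 2 W.minimalDiscriminantInt = 4 ∨ padicValInt 2 W.minimalDiscriminantInt = 8 ∨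
      padicValInt 2 W.minimalDiscriminantInt = 10 ∨ padicValInt 2 W.minimalDiscriminantInt = 11 := by
  set v : HeightOneSpectrum ℤ := (primesEquiv (R := ℤ)).symm ⟨2, Nat.prime_two⟩ with hvdef
  have hv : natGenerator v = 2 := congrArg Subtype.val ((primesEquiv (R := ℤ)).apply_symm_apply ⟨2, Nat.prime_two⟩)
  have hf : W.conductorExponent v = 3 := by
    have h1 := factorization_conductorNorm_holds W v
    rw [hv, Nat.factorization_def _ Nat.prime_two, h3] at h1
    exact h1.symm
  have hΔ : padicValInt 2 W.minimalDiscriminantInt = W.ordMinimalDiscriminant v := by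
    rw [W.ordMinimalDiscriminant_eq_padicValInt_natGenerator' v, hv]
  rw [hΔ]
  rcases kodairaSymbolAt_of_conductorExponent_eq_three_two W v hv hf with ⟨-, h⟩ | ⟨-, h⟩ | ⟨-, h⟩ | ⟨-, h⟩
  · exact Or.inl h
  · exact Or.inr (Or.inl h)
  · exact Or.inr (Or.inr (Or.inl h))
  · exact Or.inr (Or.inr (Or.inr h))

/-- **`8 ∥ N ⟹ v₂(Δ) ∈ {4, 8, 10, 11}` on a globally minimal model**, in desc's `padicValRat 2 W.Δ` currency (as `ConwayCut`'s T1 at `4 ∥ N`).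
[cite: SilvermanATAEC1994, IV.9.4 and Table 4.1] -/
theorem padicValRat_two_Δ_of_padicValNat_conductorNorm_eq_three (W : WeierstrassCurve ℚ) [W.IsElliptic] [W.IsGloballyMinimal]
    (h3 : padicValNat 2 (W.conductorNorm ℤ) = 3) :
    padicValRat 2 W.Δ = 4 ∨ padicValRat 2 W.Δ = 8 ∨ padicValRat 2 W.Δ = 10 ∨ padicValRat 2 W.Δ = 11 := by
  rw [← cast_minimalDiscriminantInt W, padicValRat.of_int]
  rcases padicValInt_two_minimalDiscriminantInt_of_padicValNat_conductorNorm_eq_three W h3 with h | h | h | h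
  · exact Or.inl (by rw [h]; rfl)
  · exact Or.inr (Or.inl (by rw [h]; rfl))
  · exact Or.inr (Or.inr (Or.inl (by rw [h]; rfl)))
  · exact Or.inr (Or.inr (Or.inr (by rw [h]; rfl)))

/-! ## §3 `8 ∥ N ⟹ c₂ ∈ {1, 2, 4}`, by type -/

/-- **Local form, by type: `f_{v₂} = 3 ⟹ (III ∧ c = 2) ∨ (I₁* ∧ c ∈ {2, 4}) ∨ (III* ∧ c = 2) ∨ (II* ∧ c = 1)`** (Tate's Steps 4, 7, 9, 10:
`localTamagawaNumber_eq_two_of_kodairaSymbolAt_eq_III_holds`, `…_Istar_succ_holds`, `…_IIIstar_holds`, `…_eq_one_of_…_IIstar_holds`).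
[cite: SilvermanATAEC1994, IV.9.4 Steps 4, 7, 9, 10 and Table 4.1] -/
theorem localTamagawaNumber_vTwo_by_type_of_conductorExponent_eq_three (W : WeierstrassCurve ℚ) [W.IsElliptic]
    (h3 : padicValNat 2 (W.conductorNorm ℤ) = 3) :
    (W.kodairaSymbolAt ((primesEquiv (R := 𝓞 ℚ)).symm ⟨2, Nat.prime_two⟩) = .III ∧
        (W.baseChange ((((primesEquiv (R := 𝓞 ℚ)).symm ⟨2, Nat.prime_two⟩)).adicCompletion ℚ)).localTamagawaNumber
          (((primesEquiv (R := 𝓞 ℚ)).symm ⟨2, Nat.prime_two⟩).adicCompletionIntegers ℚ) = 2) ∨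
      (W.kodairaSymbolAt ((primesEquiv (R := 𝓞 ℚ)).symm ⟨2, Nat.prime_two⟩) = .Istar 1 ∧
        ((W.baseChange ((((primesEquiv (R := 𝓞 ℚ)).symm ⟨2, Nat.prime_two⟩)).adicCompletion ℚ)).localTamagawaNumber
            (((primesEquiv (R := 𝓞 ℚ)).symm ⟨2, Nat.prime_two⟩).adicCompletionIntegers ℚ) = 2 ∨
          (W.baseChange ((((primesEquiv (R := 𝓞 ℚ)).symm ⟨2, Nat.prime_two⟩)).adicCompletion ℚ)).localTamagawaNumber
            (((primesEquiv (R := 𝓞 ℚ)).symm ⟨2, Nat.prime_two⟩).adicCompletionIntegers ℚ) = 4)) ∨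
      (W.kodairaSymbolAt ((primesEquiv (R := 𝓞 ℚ)).symm ⟨2, Nat.prime_two⟩) = .IIIstar ∧
        (W.baseChange ((((primesEquiv (R := 𝓞 ℚ)).symm ⟨2, Nat.prime_two⟩)).adicCompletion ℚ)).localTamagawaNumber
          (((primesEquiv (R := 𝓞 ℚ)).symm ⟨2, Nat.prime_two⟩).adicCompletionIntegers ℚ) = 2) ∨
      (W.kodairaSymbolAt ((primesEquiv (R := 𝓞 ℚ)).symm ⟨2, Nat.prime_two⟩) = .IIstar ∧
        (W.baseChange ((((primesEquiv (R := 𝓞 ℚ)).symm ⟨2, Nat.prime_two⟩)).adicCompletion ℚ)).localTamagawaNumber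
          (((primesEquiv (R := 𝓞 ℚ)).symm ⟨2, Nat.prime_two⟩).adicCompletionIntegers ℚ) = 1) := by
  haveI : PerfectField (IsLocalRing.ResidueField (((primesEquiv (R := 𝓞 ℚ)).symm ⟨2, Nat.prime_two⟩).adicCompletionIntegers ℚ)) :=
    PerfectField.ofFinite
  rcases kodairaSymbolAt_vTwo_of_padicValNat_conductorNorm_eq_three W h3 with ⟨hT, -⟩ | ⟨hT, -⟩ | ⟨hT, -⟩ | ⟨hT, -⟩
  · exact Or.inl ⟨hT, localTamagawaNumber_eq_two_of_kodairaSymbolAt_eq_III_holds _ W hT⟩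
  · exact Or.inr (Or.inl ⟨hT, localTamagawaNumber_of_kodairaSymbolAt_eq_Istar_succ_holds _ W 0 hT⟩)
  · exact Or.inr (Or.inr (Or.inl ⟨hT, localTamagawaNumber_eq_two_of_kodairaSymbolAt_eq_IIIstar_holds _ W hT⟩))
  · exact Or.inr (Or.inr (Or.inr ⟨hT, localTamagawaNumber_eq_one_of_kodairaSymbolAt_eq_IIstar_holds _ W hT⟩))

/-- **`8 ∥ N_E ⟹ c₂(E) ∈ {1, 2, 4}`** in desc's `tamagawaAt W 2` currency (`tamagawaAt_two_eq_localTamagawaNumber`, p707853).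
[cite: SilvermanATAEC1994, IV.9.4 Steps 4, 7, 9, 10 and Table 4.1] -/
theorem tamagawaAt_two_of_padicValNat_conductorNorm_eq_three (W : WeierstrassCurve ℚ) [W.IsElliptic]
    (h3 : padicValNat 2 (W.conductorNorm ℤ) = 3) :
    tamagawaAt W 2 = 1 ∨ tamagawaAt W 2 = 2 ∨ tamagawaAt W 2 = 4 := by
  rw [tamagawaAt_two_eq_localTamagawaNumber]
  rcases localTamagawaNumber_vTwo_by_type_of_conductorExponent_eq_three W h3 with ⟨-, h⟩ | ⟨-, h | h⟩ | ⟨-, h⟩ | ⟨-, h⟩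
  · exact Or.inr (Or.inl h)
  · exact Or.inr (Or.inl h)
  · exact Or.inr (Or.inr h)
  · exact Or.inr (Or.inl h)
  · exact Or.inl h

/-- **By type, in desc's currency**: at `8 ∥ N`, `c₂ = 1 ↔` the type at `2` is `II*` (the other three types have even `c₂`).
[cite: SilvermanATAEC1994, IV.9.4 Steps 4, 7, 9, 10 and Table 4.1] -/
theorem tamagawaAt_two_eq_one_iff_kodairaSymbolAt_eq_IIstar_of_padicValNat_conductorNorm_eq_three (W : WeierstrassCurve ℚ)
    [W.IsElliptic] (h3 : padicValNat 2 (W.conductorNorm ℤ) = 3) :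
    tamagawaAt W 2 = 1 ↔ W.kodairaSymbolAt ((primesEquiv (R := 𝓞 ℚ)).symm ⟨2, Nat.prime_two⟩) = .IIstar := by
  rw [tamagawaAt_two_eq_localTamagawaNumber]
  rcases localTamagawaNumber_vTwo_by_type_of_conductorExponent_eq_three W h3 with
      ⟨hT, h⟩ | ⟨hT, h | h⟩ | ⟨hT, h⟩ | ⟨hT, h⟩ <;> rw [hT, h] <;> decide

/-- **`8 ∥ N ⟹ c₂` is even unless the type is `II*`**: `c₂ ∈ {2, 4}` for `III`, `I₁*`, `III*`. [cite: SilvermanATAEC1994, IV.9.4 and Table 4.1] -/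
theorem even_tamagawaAt_two_of_kodairaSymbolAt_ne_IIstar_of_padicValNat_conductorNorm_eq_three (W : WeierstrassCurve ℚ)
    [W.IsElliptic] (h3 : padicValNat 2 (W.conductorNorm ℤ) = 3)
    (hT : W.kodairaSymbolAt ((primesEquiv (R := 𝓞 ℚ)).symm ⟨2, Nat.prime_two⟩) ≠ .IIstar) : Even (tamagawaAt W 2) := by
  rcases tamagawaAt_two_of_padicValNat_conductorNorm_eq_three W h3 with h | h | h
  · exact absurd ((tamagawaAt_two_eq_one_iff_kodairaSymbolAt_eq_IIstar_of_padicValNat_conductorNorm_eq_three W h3).mp h) hT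
  · rw [h]; exact even_two
  · rw [h]; exact ⟨2, rfl⟩

/-! ## §4 `8 ∥ N ⟹ E(ℚ)[3] = 0` -/

/-- **`8 ∥ N_E ⟹ E(ℚ)` has no point of order `3`** (`¬ RamanujanCut.HasRationalThreeTorsion W`): the reduction at `2` is additive, so a
rational `3`-torsion point forces `3 ∣ c₂` (p707853 `three_dvd_localTamagawaNumber_vTwo_of_hasRationalThreeTorsion`: `E₁(ℚ₂)` and
`Ẽ_ns(𝔽₂) ≅ 𝔾_a(𝔽₂)` have no `3`-torsion, Silverman *AEC* VII.2.1 / VII.3.1), whereas `c₂ ∈ {1, 2, 4}` at `8 ∥ N`.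
[cite: SilvermanAEC2009, VII.2 Prop. 2.1 and VII.3 Prop. 3.1] [cite: SilvermanATAEC1994, IV.9.4 and Table 4.1] -/
theorem not_hasRationalThreeTorsion_of_padicValNat_conductorNorm_eq_three (W : WeierstrassCurve ℚ) [W.IsElliptic]
    (h3 : padicValNat 2 (W.conductorNorm ℤ) = 3) : ¬ HasRationalThreeTorsion W := by
  intro hT
  haveI : PerfectField (IsLocalRing.ResidueField (((primesEquiv (R := 𝓞 ℚ)).symm ⟨2, Nat.prime_two⟩).adicCompletionIntegers ℚ)) :=
    PerfectField.ofFinite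
  have hf := conductorExponent_vTwo_eq_three_of_padicValNat_conductorNorm W h3
  have hadd : W.HasAdditiveReductionAt ((primesEquiv (R := 𝓞 ℚ)).symm ⟨2, Nat.prime_two⟩) :=
    (W.two_le_conductorExponent_iff_holds ((primesEquiv (R := 𝓞 ℚ)).symm ⟨2, Nat.prime_two⟩)).mp (by rw [hf]; norm_num)
  have h3c := three_dvd_localTamagawaNumber_vTwo_of_hasRationalThreeTorsion W hadd hT
  rw [← tamagawaAt_two_eq_localTamagawaNumber] at h3c
  rcases tamagawaAt_two_of_padicValNat_conductorNorm_eq_three W h3 with h | h | h <;> rw [h] at h3c <;> omega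

/-- The same from `8 ∣ N`, `16 ∤ N`. [cite: SilvermanAEC2009, VII.2 Prop. 2.1 and VII.3 Prop. 3.1] -/
theorem not_hasRationalThreeTorsion_of_eight_dvd_conductorNorm (W : WeierstrassCurve ℚ) [W.IsElliptic]
    (h8 : 2 ^ 3 ∣ W.conductorNorm ℤ) (h16 : ¬ 2 ^ 4 ∣ W.conductorNorm ℤ) : ¬ HasRationalThreeTorsion W :=
  not_hasRationalThreeTorsion_of_padicValNat_conductorNorm_eq_three W (padicValNat_conductorNorm_eq_three_of_dvd W h8 h16)

end Summit.BirchSwinnertonDyer.BirchSwinnertonDyer.Theorems.ManinLocalTwoThree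

end
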